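import Literature.Probability.Percolation.LonelyClusterExchange
import HarnessLib

/-!
# Passenger form of the lonely-cluster transfer (BHK 2006 Thm. 1.5, corollary)

Topic `Literature/Probability/Percolation`.  Bond percolation `μ = prodBernoulli w` on a finite vertex type, a
finite set `A` of relays, a level `j`; `π(v) = A.filter (v ↔ ·)`, `R_v = {|π(v)| ≤ j}` ("`v` is lonely"),
`D = {s ↮ t}`.

Van den Berg–Häggström–Kahn's Theorem 1.5 ([VandenbergHaggstromKahn2005, Thm. 1.5 p. 7]; tree: `twoClusterExchange`)
says that on `D` the events closed under (enlarging `C_s`, shrinking `C_t`) — type `(+)` — are pairwise positively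
correlated and negatively correlated with the type `(−)` events.  Consequently any comparison
`μ(D ∩ R_s) ≤ μ(D ∩ R_t)` of the two loneliness probabilities on `D` (e.g. the conclusion of separation
stability / `observerSet_le_of_lonelier`) can carry a PASSENGER: for every vertex `x`,

* `passengerLonelyTransfer`:
  `μ(D ∩ R_s ∩ R_tᶜ ∩ {s ↔ x}) ≤ μ(D ∩ R_t ∩ R_sᶜ ∩ {s ↔ x})`
  ("given `s ↮ t` and a passenger `x` riding with `s`, '`s` lonely, `t` crowded' is no likelier than
  '`t` lonely, `s` crowded'").  Proof: `{s ↔ x}` and `R_t ∩ R_sᶜ` are of type `(+)`, `R_s ∩ R_tᶜ` of type `(−)`;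
  two applications of `twoClusterExchange` around the hypothesis.
* `passengerLonelyTransfer'`: the same with the common part `R_s ∩ R_t` added back:
  `μ(D ∩ R_s ∩ {s ↔ x}) ≤ μ(D ∩ R_t ∩ {s ↔ x})`.

Used by the `NoHeavyLowerTail` line (stmt-CriticalPhenomena-4575): it is the exchange step of the pattern-lightest
bound for relay-neighboured observers.  No definition and no named fact is introduced.
-/

noncomputable section

open MeasureTheory Set
open Literature.Probability.LatticeModels (prodBernoulli)
open scoped Classical

namespace Literature.Probability.Percolation

variable {V : Type*}

open TwoClusterExchange LonelyClusterExchange in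
/-- **Passenger lonely transfer.**  For `s ≠ t`, a vertex `x`, relays `A`, level `j`, `D = {s ↮ t}`,
`R_v = {|π(v)| ≤ j}`: if `μ(D ∩ R_s) ≤ μ(D ∩ R_t)` then
`μ(D ∩ (R_s ∩ R_tᶜ ∩ {s ↔ x})) ≤ μ(D ∩ (R_t ∩ R_sᶜ ∩ {s ↔ x}))`.
[cite: VandenbergHaggstromKahn2005, Thm. 1.5 (p. 7) — corollary via `twoClusterExchange`] -/
theorem passengerLonelyTransfer [Fintype V] (w : Sym2 V → unitInterval) (A : Finset V) (j : ℕ)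
    {s t : V} (hst : s ≠ t) (x : V)
    (h : (prodBernoulli w).real ((openConn s t)ᶜ ∩
        {ω : BondConfig V | (A.filter fun z => ω ∈ openConn s z).card ≤ j}) ≤
      (prodBernoulli w).real ((openConn s t)ᶜ ∩
        {ω : BondConfig V | (A.filter fun z => ω ∈ openConn t z).card ≤ j})) :
    (prodBernoulli w).real ((openConn s t)ᶜ ∩
        ({ω : BondConfig V | (A.filter fun z => ω ∈ openConn s z).card ≤ j} ∩
          {ω : BondConfig V | (A.filter fun z => ω ∈ openConn t z).card ≤ j}ᶜ ∩ openConn s x)) ≤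
      (prodBernoulli w).real ((openConn s t)ᶜ ∩
        ({ω : BondConfig V | (A.filter fun z => ω ∈ openConn t z).card ≤ j} ∩
          {ω : BondConfig V | (A.filter fun z => ω ∈ openConn s z).card ≤ j}ᶜ ∩ openConn s x)) := by
  set μ := prodBernoulli w with hμ
  set D : Set (BondConfig V) := (openConn s t)ᶜ with hD
  set Rs : Set (BondConfig V) := {ω | (A.filter fun z => ω ∈ openConn s z).card ≤ j} with hRs
  set Rt : Set (BondConfig V) := {ω | (A.filter fun z => ω ∈ openConn t z).card ≤ j} with hRt
  set E : Set (BondConfig V) := openConn s x with hE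
  have hmeas : ∀ S : Set (BondConfig V), MeasurableSet S := fun S => (Set.toFinite S).measurableSet
  -- types for the pair (s, t)
  have hEp : ∀ ⦃ω ω' : BondConfig V⦄, openEdgeCluster ω s ⊆ openEdgeCluster ω' s →
      openEdgeCluster ω' t ⊆ openEdgeCluster ω t → ω ∈ E → ω' ∈ E :=
    fun ω ω' h1 h2 hω => typePlus_openConn s t x h1 h2 hω
  have hRtp : ∀ ⦃ω ω' : BondConfig V⦄, openEdgeCluster ω s ⊆ openEdgeCluster ω' s →
      openEdgeCluster ω' t ⊆ openEdgeCluster ω t → ω ∈ Rt → ω' ∈ Rt :=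
    fun ω ω' h1 h2 hω => typePlus_card_le A j s t h1 h2 hω
  have hRsm : ∀ ⦃ω ω' : BondConfig V⦄, openEdgeCluster ω' s ⊆ openEdgeCluster ω s →
      openEdgeCluster ω t ⊆ openEdgeCluster ω' t → ω ∈ Rs → ω' ∈ Rs :=
    fun ω ω' h1 h2 hω => typeMinus_card_le A j s t h1 h2 hω
  -- A⁻ := Rs ∩ Rtᶜ is of type (−), B⁺ := Rt ∩ Rsᶜ of type (+)
  have hAm : ∀ ⦃ω ω' : BondConfig V⦄, openEdgeCluster ω' s ⊆ openEdgeCluster ω s →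
      openEdgeCluster ω t ⊆ openEdgeCluster ω' t → ω ∈ Rs ∩ Rtᶜ → ω' ∈ Rs ∩ Rtᶜ := by
    intro ω ω' h1 h2 hω
    refine ⟨hRsm h1 h2 hω.1, fun h' => hω.2 (hRtp h1 h2 h')⟩
  have hBp : ∀ ⦃ω ω' : BondConfig V⦄, openEdgeCluster ω s ⊆ openEdgeCluster ω' s →
      openEdgeCluster ω' t ⊆ openEdgeCluster ω t → ω ∈ Rt ∩ Rsᶜ → ω' ∈ Rt ∩ Rsᶜ := by
    intro ω ω' h1 h2 hω
    refine ⟨hRtp h1 h2 hω.1, fun h' => hω.2 (hRsm h1 h2 h')⟩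
  have huniv_p : ∀ ⦃ω ω' : BondConfig V⦄, openEdgeCluster ω s ⊆ openEdgeCluster ω' s →
      openEdgeCluster ω' t ⊆ openEdgeCluster ω t → ω ∈ (univ : Set (BondConfig V)) → ω' ∈ (univ : Set _) :=
    fun _ _ _ _ _ => mem_univ _
  have huniv_m : ∀ ⦃ω ω' : BondConfig V⦄, openEdgeCluster ω' s ⊆ openEdgeCluster ω s →
      openEdgeCluster ω t ⊆ openEdgeCluster ω' t → ω ∈ (univ : Set (BondConfig V)) → ω' ∈ (univ : Set _) :=
    fun _ _ _ _ _ => mem_univ _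
  -- step 1: negative correlation of E (+) with A⁻ given D
  have step1 := twoClusterExchange w hst (A₁ := E) (A₂ := univ) (B₁ := Rs ∩ Rtᶜ) (B₂ := univ)
    hEp huniv_p hAm huniv_m
  -- step 3: positive correlation of B⁺ with E given D
  have step3 := twoClusterExchange w hst (A₁ := Rt ∩ Rsᶜ) (A₂ := E) (B₁ := univ) (B₂ := univ)
    hBp hEp huniv_m huniv_m
  simp only [inter_univ] at step1 step3
  -- step 2: the hypothesis without the common part
  have step2 : μ.real (D ∩ (Rs ∩ Rtᶜ)) ≤ μ.real (D ∩ (Rt ∩ Rsᶜ)) := by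
    have e1 : μ.real (D ∩ Rs) = μ.real (D ∩ (Rs ∩ Rt)) + μ.real (D ∩ (Rs ∩ Rtᶜ)) := by
      rw [← measureReal_inter_add_sdiff (s := D ∩ Rs) (hmeas Rt)]
      congr 1
      · congr 1; ext ω; simp only [mem_inter_iff]; tauto
      · congr 1; ext ω; simp only [mem_inter_iff, mem_sdiff, mem_compl_iff]; tauto
    have e2 : μ.real (D ∩ Rt) = μ.real (D ∩ (Rs ∩ Rt)) + μ.real (D ∩ (Rt ∩ Rsᶜ)) := by
      rw [← measureReal_inter_add_sdiff (s := D ∩ Rt) (hmeas Rs)]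
      congr 1
      · congr 1; ext ω; simp only [mem_inter_iff]; tauto
      · congr 1; ext ω; simp only [mem_inter_iff, mem_sdiff, mem_compl_iff]; tauto
    have := h
    rw [e1, e2] at this
    linarith
  -- rewrite the goal sets
  have eL : D ∩ (Rs ∩ Rtᶜ ∩ E) = D ∩ (E ∩ (Rs ∩ Rtᶜ)) := by
    ext ω; simp only [mem_inter_iff, mem_compl_iff]; tauto
  rw [eL]
  -- chain
  by_cases hD0 : μ.real D = 0
  · have h0 : μ.real (D ∩ (E ∩ (Rs ∩ Rtᶜ))) ≤ μ.real D :=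
      measureReal_mono inter_subset_left (measure_ne_top _ _)
    rw [hD0] at h0
    exact h0.trans measureReal_nonneg
  · have hDpos : 0 < μ.real D := lt_of_le_of_ne measureReal_nonneg (Ne.symm hD0)
    have hE0 : 0 ≤ μ.real (D ∩ E) := measureReal_nonneg
    -- μ(D∩E∩A⁻)·μ(D) ≤ μ(D∩E)·μ(D∩A⁻) ≤ μ(D∩E)·μ(D∩B⁺) ≤ μ(D∩(B⁺∩E))·μ(D)
    have c1 : μ.real (D ∩ (E ∩ (Rs ∩ Rtᶜ))) * μ.real D ≤ μ.real (D ∩ E) * μ.real (D ∩ (Rs ∩ Rtᶜ)) := step1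
    have c2 : μ.real (D ∩ E) * μ.real (D ∩ (Rs ∩ Rtᶜ)) ≤ μ.real (D ∩ E) * μ.real (D ∩ (Rt ∩ Rsᶜ)) :=
      mul_le_mul_of_nonneg_left step2 hE0
    have c3 : μ.real (D ∩ (Rt ∩ Rsᶜ)) * μ.real (D ∩ E) ≤ μ.real (D ∩ (Rt ∩ Rsᶜ ∩ E)) * μ.real D := step3
    have c4 : μ.real (D ∩ (E ∩ (Rs ∩ Rtᶜ))) * μ.real D ≤ μ.real (D ∩ (Rt ∩ Rsᶜ ∩ E)) * μ.real D := by
      calc μ.real (D ∩ (E ∩ (Rs ∩ Rtᶜ))) * μ.real D ≤ μ.real (D ∩ E) * μ.real (D ∩ (Rs ∩ Rtᶜ)) := c1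
        _ ≤ μ.real (D ∩ E) * μ.real (D ∩ (Rt ∩ Rsᶜ)) := c2
        _ = μ.real (D ∩ (Rt ∩ Rsᶜ)) * μ.real (D ∩ E) := mul_comm _ _
        _ ≤ μ.real (D ∩ (Rt ∩ Rsᶜ ∩ E)) * μ.real D := c3
    exact le_of_mul_le_mul_right c4 hDpos

open TwoClusterExchange LonelyClusterExchange in
/-- **Passenger lonely transfer, cumulative form.**  Under the same hypothesis,
`μ(D ∩ R_s ∩ {s ↔ x}) ≤ μ(D ∩ R_t ∩ {s ↔ x})` (add the common part `D ∩ R_s ∩ R_t ∩ {s ↔ x}` to both sides of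
`passengerLonelyTransfer`). [cite: VandenbergHaggstromKahn2005, Thm. 1.5 (p. 7) — corollary] -/
theorem passengerLonelyTransfer' [Fintype V] (w : Sym2 V → unitInterval) (A : Finset V) (j : ℕ)
    {s t : V} (hst : s ≠ t) (x : V)
    (h : (prodBernoulli w).real ((openConn s t)ᶜ ∩
        {ω : BondConfig V | (A.filter fun z => ω ∈ openConn s z).card ≤ j}) ≤
      (prodBernoulli w).real ((openConn s t)ᶜ ∩
        {ω : BondConfig V | (A.filter fun z => ω ∈ openConn t z).card ≤ j})) :
    (prodBernoulli w).real ((openConn s t)ᶜ ∩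
        ({ω : BondConfig V | (A.filter fun z => ω ∈ openConn s z).card ≤ j} ∩ openConn s x)) ≤
      (prodBernoulli w).real ((openConn s t)ᶜ ∩
        ({ω : BondConfig V | (A.filter fun z => ω ∈ openConn t z).card ≤ j} ∩ openConn s x)) := by
  set μ := prodBernoulli w with hμ
  set D : Set (BondConfig V) := (openConn s t)ᶜ with hD
  set Rs : Set (BondConfig V) := {ω | (A.filter fun z => ω ∈ openConn s z).card ≤ j} with hRs
  set Rt : Set (BondConfig V) := {ω | (A.filter fun z => ω ∈ openConn t z).card ≤ j} with hRt
  set E : Set (BondConfig V) := openConn s x with hE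
  have hmeas : ∀ S : Set (BondConfig V), MeasurableSet S := fun S => (Set.toFinite S).measurableSet
  have key := passengerLonelyTransfer w A j hst x h
  have e1 : μ.real (D ∩ (Rs ∩ E)) = μ.real (D ∩ (Rs ∩ E) ∩ Rt) + μ.real (D ∩ (Rs ∩ Rtᶜ ∩ E)) := by
    rw [← measureReal_inter_add_sdiff (s := D ∩ (Rs ∩ E)) (hmeas Rt)]
    congr 2
    ext ω; simp only [mem_inter_iff, mem_sdiff, mem_compl_iff]; tauto
  have e2 : μ.real (D ∩ (Rt ∩ E)) = μ.real (D ∩ (Rs ∩ E) ∩ Rt) + μ.real (D ∩ (Rt ∩ Rsᶜ ∩ E)) := by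
    rw [← measureReal_inter_add_sdiff (s := D ∩ (Rt ∩ E)) (hmeas Rs)]
    congr 1
    · congr 1; ext ω; simp only [mem_inter_iff]; tauto
    · congr 1; ext ω; simp only [mem_inter_iff, mem_sdiff, mem_compl_iff]; tauto
  rw [e1, e2]
  linarith

end Literature.Probability.Percolation

end
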